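import Summits.HodgeConjecture.HodgeConjecture.Theorems.HodgeLocusCensusLinearCycleRank
import Literature.AlgebraicGeometry.Villaflor2022.TwoLinearCyclesPeriodMatrixRank
import HarnessLib

/-!
# HodgeLocusCensusTwoLinearCyclesRank — PROVED for ALL (n, d, m): the census rank of `u·[ℙ_{a,b}] + v·[ℙ_{a',b}]`
# (two linear cycles of the Fermat variety with the same pairing `b`; cell pub-hlocus, lit-g16 bridge)
HONEST FRAMING: certified instances and evidence bearing on the general Hodge conjecture; no claim.

For `n` even with `n + 2 ≤ (n/2)·d`, any permutation `b`, twist vectors `a, a'` and `u, v ∈ ℚ^×`, the census certificate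
`IvhsRankEq n d r [(u, ⟨a,b⟩), (v, ⟨a',b⟩)]` holds with
`r = 2·(C(n/2+d,d) − (n/2+1)²) − ciH_c(d) − ciH_c((n/2)d − n − 2)` (`pairRank n d c`), where
`c = #{e ≤ n/2 : a_{2e+1} ≡ a'_{2e+1} (mod d)}` (`commonCount`, `= m + 1` for `ℙ ∩ ℙ̌ = ℙ^m`) is required to be `< n/2 + 1`
(distinct cycles) and `ciH_c(k) = #{β ∈ [0,d−2]^c : |β| = k}` — Villaflor, manuscripta math. 167 (2022) Prop. 1 / Thm. 3
(proof) and Movasati–Villaflor 2018 Thm. 1–2, Movasati 2016 Thm. 13, as the Literature theorem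
`Literature.AlgebraicGeometry.Villaflor2022.rank_periodMatrix_two_linearCycles` (`intdim − exact excess`). Consequences: every
'standard pair' row `[(u, standardP n), (v, standardPc n m t)]` (`m < n/2`, `t ≢ 0 mod d`) at once
(`ivhsRankEq_standardPair`), e.g. the five-tuple `(4,4,0 | 11, 12)` and the cubic rows `(6,3,1) ↦ 6`, `(8,3,2) ↦ 16`, …,
and `rank = intdim n d (m+1) ⟺ 2 < (n/2 − m − 1)(d − 2)` (Villaflor's threshold) via
`Villaflor2022.rank_eq_hilbert_inf_iff`. This file only identifies the census matrix with the Literature one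
(via `ivhsMatrix_eq_periodMatrix` of `HodgeLocusCensusLinearCycleRank`) and counts the common pairs.
-/

namespace Summit.HodgeConjecture.HodgeConjecture.HodgeLocus.Census

open Literature.AlgebraicGeometry
open Literature.AlgebraicGeometry.Kloosterman2023 (ciHilbert)

/-- The number of COMMON pairs of `ℙ_{a,b}` and `ℙ_{a',b}`: `#{e ≤ n/2 : a_{2e+1} ≡ a'_{2e+1} (mod d)}` (`= m + 1` when
`ℙ_{a,b} ∩ ℙ_{a',b} = ℙ^m`; computable). -/
def commonCount (n d : ℕ) (a a' : Fin (n+2) → ℕ) : ℕ :=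
  (Finset.univ.filter fun e : Fin (n/2+1) => a ⟨2*e+1, by omega⟩ % d = a' ⟨2*e+1, by omega⟩ % d).card

/-- The rank of `[p_{i+j}(uℙ + vℙ̌)]` for two distinct linear cycles with `c` common pairs:
`2·(C(n/2+d,d) − (n/2+1)²) − ciH_c(d) − ciH_c((n/2)d − n − 2)` (`= intdim n d c −` exact excess). -/
def pairRank (n d c : ℕ) : ℕ :=
  2 * ((n / 2 + d).choose d - (n / 2 + 1) ^ 2) - ciHilbert (List.replicate c (d - 1)) d -
    ciHilbert (List.replicate c (d - 1)) (n / 2 * d - n - 2)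

/-- The census matrix of `u·[P] + v·[P']` is Movasati's period matrix at MV18's combined period vector
(the two-term case of `ivhsMatrix_eq_periodMatrix` of `HodgeLocusCensusLinearCycleRank`). -/
private theorem ivhsMatrix_pair {K : Type*} [Field K] (n d : ℕ) (ζ : K) (u v : ℚ) (P P' : LinearCycle n) :
    ivhsMatrix n d ζ [(u, P), (v, P')] = Movasati2016.periodMatrix (n+2) d (n/2*d-n-2) d
      (MovasatiVillaflor2018.combPeriod n d ζ [((u : K), P.a, P.b), ((v : K), P'.a, P'.b)]) := by
  rw [ivhsMatrix_eq_periodMatrix]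
  rfl

/-- Powers of a primitive `k`-th root of unity in a field agree iff the exponents agree mod `k`. -/
private theorem pow_eq_pow_iff_modEq_of_isPrimitiveRoot {K : Type*} [Field K] {ζ : K} {k : ℕ}
    (hζ : IsPrimitiveRoot ζ k) (hk : k ≠ 0) (i j : ℕ) : ζ ^ i = ζ ^ j ↔ i ≡ j [MOD k] := by
  obtain ⟨u, rfl⟩ := hζ.isUnit hk
  have hu : IsPrimitiveRoot u k := IsPrimitiveRoot.coe_units_iff.mp hζ
  rw [← Units.val_pow_eq_pow_val, ← Units.val_pow_eq_pow_val, Units.val_inj, pow_eq_pow_iff_modEq, ← hu.eq_orderOf]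

/-- Over a field with a primitive `2d`-th root of unity `ζ` (`d ≠ 0`), the pairs on which the twists `ζ^{1+2a_{2e+1}}`
agree are exactly those with `a_{2e+1} ≡ a'_{2e+1} (mod d)`. -/
theorem card_commonPairs_eq {K : Type*} [Field K] [DecidableEq K] {n d : ℕ} (hd : d ≠ 0) {ζ : K}
    (hζ : IsPrimitiveRoot ζ (2*d)) (a a' : Fin (n+2) → ℕ) :
    (Villaflor2022.commonPairs n ζ a a').card = commonCount n d a a' := by
  unfold Villaflor2022.commonPairs Villaflor2022.agreePairs commonCount
  congr 1
  ext e
  simp only [Finset.mem_filter, Finset.mem_univ, true_and, MovasatiVillaflor2018.twist]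
  rw [pow_eq_pow_iff_modEq_of_isPrimitiveRoot hζ (by omega)]
  constructor
  · intro h
    exact Nat.ModEq.mul_left_cancel' two_ne_zero (Nat.ModEq.add_left_cancel' 1 h)
  · intro h
    have h' : a ⟨2*e+1, by omega⟩ ≡ a' ⟨2*e+1, by omega⟩ [MOD d] := h
    exact Nat.ModEq.add_left 1 (Nat.ModEq.mul_left' 2 h')

/-- **EVERY 'same pairing' two-linear-cycle row of the census, all `(n, d, m)` at once**: for `n` even,
`n + 2 ≤ (n/2)·d`, `u, v ≠ 0` and twist vectors with `c = commonCount n d a a' < n/2 + 1` common pairs (distinct cycles),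
`IvhsRankEq n d (pairRank n d c) [(u, ⟨a, b⟩), (v, ⟨a', b⟩)]`. -/
theorem ivhsRankEq_two_linearCycles {n d : ℕ} (hn : Even n) (hN : n + 2 ≤ n / 2 * d) (b : Equiv.Perm (Fin (n+2)))
    (a a' : Fin (n+2) → ℕ) (hc : commonCount n d a a' < n / 2 + 1) {u v : ℚ} (hu : u ≠ 0) (hv : v ≠ 0) :
    IvhsRankEq n d (pairRank n d (commonCount n d a a')) [(u, ⟨a, b⟩), (v, ⟨a', b⟩)] := by
  intro K _ _ ζ hζ
  classical
  have hd0 : 2 * d ≠ 0 := fun h => by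
    have hd : d = 0 := by omega
    subst hd
    simp at hN
  have hζ0 : ζ ≠ 0 := hζ.ne_zero hd0
  have hcard := card_commonPairs_eq (K := K) (n := n) (by omega) hζ a a'
  have hne : MovasatiVillaflor2018.twist n ζ a ≠ MovasatiVillaflor2018.twist n ζ a' := by
    intro h
    have hall : (Villaflor2022.commonPairs n ζ a a').card = n / 2 + 1 := by
      unfold Villaflor2022.commonPairs Villaflor2022.agreePairs
      rw [Finset.filter_true_of_mem fun e _ => congr_fun h e, Finset.card_univ, Fintype.card_fin]
    omega
  rw [ivhsMatrix_pair]
  have h := Villaflor2022.rank_periodMatrix_two_linearCycles ζ a a' b hn hN hζ0 hne (u := (u : K)) (v := (v : K))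
    (by exact_mod_cast hu) (by exact_mod_cast hv)
  rw [hcard] at h
  exact h

/-- `#{e : Fin p | e < r} = r` for `r ≤ p`. -/
private theorem card_filter_val_lt {p r : ℕ} (hrp : r ≤ p) :
    (Finset.univ.filter fun j : Fin p => (j : ℕ) < r).card = r := by
  have h : (Finset.univ.filter fun j : Fin p => (j : ℕ) < r).map Fin.valEmbedding = Finset.range r := by
    ext x
    simp only [Finset.mem_map, Finset.mem_filter, Finset.mem_univ, true_and, Fin.valEmbedding_apply,
      Finset.mem_range]
    constructor
    · rintro ⟨j, hj, rfl⟩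
      exact hj
    · intro hx
      exact ⟨⟨x, by omega⟩, hx, rfl⟩
  rw [← Finset.card_map Fin.valEmbedding, h, Finset.card_range]

/-- The standard pair `P = standardP n`, `P̌ = standardPc n m t` (`b = id`; twist `t` on the last `n/2 − m` pairs) has
`m + 1` common pairs when `m ≤ n/2` and `t ≢ 0 (mod d)`. -/
theorem commonCount_standardPair {n d m t : ℕ} (hm : m ≤ n / 2) (ht : t % d ≠ 0) :
    commonCount n d (standardP n).a (standardPc n m t).a = m + 1 := by
  unfold commonCount
  have hfilter : (Finset.univ.filter fun e : Fin (n/2+1) =>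
      (standardP n).a ⟨2*e+1, by omega⟩ % d = (standardPc n m t).a ⟨2*e+1, by omega⟩ % d) =
      Finset.univ.filter fun e : Fin (n/2+1) => (e : ℕ) < m + 1 := by
    refine Finset.filter_congr fun e _ => ?_
    have h1 : (2 * (e : ℕ) + 1) % 2 = 1 := by omega
    have h2 : (2 * (e : ℕ) + 1) / 2 = (e : ℕ) := by omega
    simp only [standardP, standardPc, h1, h2, true_and, Nat.zero_mod, ge_iff_le]
    by_cases he : m + 1 ≤ (e : ℕ)
    · rw [if_pos he]
      constructor
      · intro h
        exact absurd h.symm ht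
      · intro h
        exfalso
        omega
    · rw [if_neg he]
      simp only [Nat.zero_mod, true_iff]
      omega
  rw [hfilter, card_filter_val_lt (by omega)]

/-- **Every standard-pair row at once**: for `n` even, `n + 2 ≤ (n/2)·d`, `m < n/2`, `t ≢ 0 (mod d)`, `u, v ≠ 0`:
`IvhsRankEq n d (pairRank n d (m+1)) [(u, standardP n), (v, standardPc n m t)]` (`m < n/2`) — rank
`= 2·(C(n/2+d,d) − (n/2+1)²) − ciH_{m+1}(d) − ciH_{m+1}((n/2)d−n−2)`. -/
theorem ivhsRankEq_standardPair {n d m t : ℕ} (hn : Even n) (hN : n + 2 ≤ n / 2 * d) (hm : m < n / 2)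
    (ht : t % d ≠ 0) {u v : ℚ} (hu : u ≠ 0) (hv : v ≠ 0) :
    IvhsRankEq n d (pairRank n d (m + 1)) [(u, standardP n), (v, standardPc n m t)] := by
  have h := ivhsRankEq_two_linearCycles hn hN 1 (standardP n).a (standardPc n m t).a
    (by rw [commonCount_standardPair hm.le ht]; omega) hu hv
  rw [commonCount_standardPair hm.le ht] at h
  exact h

/-! ## Instances (numbers of record re-derived from the general theorem) -/

/-- Movasati §6 five-tuple `(4,4,0 | 11, 12)`: rank 11 for `[P] + [P_c]`, `P ∩ P_c = ℙ^0` (`pairRank 4 4 1 = 12 − 1`). -/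
theorem ivhsRankEq_pair_4_4_0 : IvhsRankEq 4 4 11 [(1, standardP 4), (1, standardPc 4 0 1)] := by
  have h := ivhsRankEq_standardPair (n := 4) (d := 4) (m := 0) (t := 1) ⟨2, rfl⟩ (by norm_num) (by norm_num)
    (by decide) one_ne_zero one_ne_zero
  rwa [show pairRank 4 4 (0 + 1) = 11 by decide] at h

/-- … and the difference class `[P] − [P_c]` (`(4,4,0)`, λ = −1): rank 11 as well. -/
theorem ivhsRankEq_pair_4_4_0_difference : IvhsRankEq 4 4 11 [(1, standardP 4), (-1, standardPc 4 0 1)] := by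
  have h := ivhsRankEq_standardPair (n := 4) (d := 4) (m := 0) (t := 1) (u := 1) (v := -1) ⟨2, rfl⟩ (by norm_num)
    (by norm_num) (by decide) one_ne_zero (by norm_num)
  rwa [show pairRank 4 4 (0 + 1) = 11 by decide] at h

/-- Cubic standard pairs `(n,3,m)`, `c = n/2 − m = 2`: `(6,3,1) ↦ 6`, `(8,3,2) ↦ 16`, `(10,3,3) ↦ 32`, `(12,3,4) ↦ 55`,
`(14,3,5) ↦ 86` (intdim minus excess `n/2 − 1`). -/
theorem ivhsRankEq_cubic_c2 :
    IvhsRankEq 6 3 6 [(1, standardP 6), (1, standardPc 6 1 1)] ∧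
    IvhsRankEq 8 3 16 [(1, standardP 8), (1, standardPc 8 2 1)] ∧
    IvhsRankEq 10 3 32 [(1, standardP 10), (1, standardPc 10 3 1)] ∧
    IvhsRankEq 12 3 55 [(1, standardP 12), (1, standardPc 12 4 1)] ∧
    IvhsRankEq 14 3 86 [(1, standardP 14), (1, standardPc 14 5 1)] := by
  refine ⟨?_, ?_, ?_, ?_, ?_⟩
  · have h := ivhsRankEq_standardPair (n := 6) (d := 3) (m := 1) (t := 1) ⟨3, rfl⟩ (by norm_num) (by norm_num)
      (by decide) one_ne_zero one_ne_zero
    rwa [show pairRank 6 3 (1 + 1) = 6 by decide] at h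
  · have h := ivhsRankEq_standardPair (n := 8) (d := 3) (m := 2) (t := 1) ⟨4, rfl⟩ (by norm_num) (by norm_num)
      (by decide) one_ne_zero one_ne_zero
    rwa [show pairRank 8 3 (2 + 1) = 16 by decide] at h
  · have h := ivhsRankEq_standardPair (n := 10) (d := 3) (m := 3) (t := 1) ⟨5, rfl⟩ (by norm_num) (by norm_num)
      (by decide) one_ne_zero one_ne_zero
    rwa [show pairRank 10 3 (3 + 1) = 32 by decide] at h
  · have h := ivhsRankEq_standardPair (n := 12) (d := 3) (m := 4) (t := 1) ⟨6, rfl⟩ (by norm_num) (by norm_num)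
      (by decide) one_ne_zero one_ne_zero
    rwa [show pairRank 12 3 (4 + 1) = 55 by decide] at h
  · have h := ivhsRankEq_standardPair (n := 14) (d := 3) (m := 5) (t := 1) ⟨7, rfl⟩ (by norm_num) (by norm_num)
      (by decide) one_ne_zero one_ne_zero
    rwa [show pairRank 14 3 (5 + 1) = 86 by decide] at h

end Summit.HodgeConjecture.HodgeConjecture.HodgeLocus.Census
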